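import Literature.AlgebraicGeometry.Crystalline.DeRhamComplexSheaf
import Literature.AlgebraicGeometry.Motives.VarietiesGeometricallyIntegralProofs
import Mathlib.AlgebraicGeometry.Morphisms.Proper
import Mathlib.AlgebraicGeometry.Morphisms.Smooth
import Mathlib.RingTheory.Smooth.StandardSmoothCotangent
import Mathlib.RingTheory.Smooth.Flat
import Mathlib.RingTheory.Flat.TorsionFree
import Mathlib.RingTheory.Localization.Integral
import Mathlib.RingTheory.Derivation.Basic
import Mathlib.FieldTheory.Perfect
import HarnessLib

/-!
# Global functions on a smooth proper scheme over a domain of characteristic `0` are closed: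
# `d f = 0`

Let `R₀` be an integral domain of characteristic `0` with fraction field `K₀`, and let
`X → Spec R₀` be smooth of relative dimension `d` (Mathlib's `SmoothOfRelativeDimension d`) and
universally closed (e.g. proper). Then for every GLOBAL function `f ∈ Γ(X, 𝒪_X)` the Kähler
differential `d f` vanishes: on every affine open `V` on which the structure map is standard smooth,
`D (f|_V) = 0` in `Ω[Γ(X,V)⁄R₀]` (`kaehlerDifferential_D_map_eq_zero`), and consequently the
degree-`0` differential `𝒪_X = Ω⁰ →ᵈ Ω¹` of the algebraic de Rham complex
(`Crystalline.algebraicDeRhamComplex`) kills every global section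
(`algebraicDeRhamComplex_d_app_top_eq_zero`). This is the `(a, b) = (0, 0)` entry of the
`E₁`-degeneration of the Hodge–de Rham spectral sequence (P. Deligne, *Théorème de Lefschetz et
critères de dégénérescence de suites spectrales*, Publ. Math. IHÉS 35 (1968), Thm. 5.5) — the one
entry with an elementary proof, recorded here integrally (no torsion) and over any such base.

Proof (folklore). `Γ(X, 𝒪_X)` is integral over `R₀` because `X → Spec R₀` is universally closed
(Mathlib `isIntegral_appTop_of_universallyClosed`; Stacks 01WB-style argument), so `f|_V` is integral
over `R₀`. The chart ring `B = Γ(X, V)` is standard smooth over `R₀`, hence flat, so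
`B ↪ K₀ ⊗ B`, and `K₀ ⊗ B` is smooth over the field `K₀`, hence reduced
(`Motives.isReduced_of_smooth_of_field`, Stacks 056T); `Ω[B⁄R₀]` is free over `B`, hence without
`R₀`-torsion. The purely algebraic lemma `derivation_eq_zero_of_isIntegral_of_injective` then
applies: the minimal polynomial `P` over `K₀` of an element `x` of a reduced `K₀`-algebra is
squarefree, hence separable in characteristic `0`, so `v P' + u P = 1`; clearing denominators and
applying the derivation to `(cP)(f) = 0` gives `c P'(f) · Df = 0` with `c P'(f)` dividing a
non-zero constant of `R₀`, whence `Df = 0` by torsion-freeness.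

Everything is proved; no named facts. NOT here: the hypercohomological reading (the connecting
homomorphism `ℍ⁰(σ≤0 Ω•) → H⁰(Ω¹)` of the stupid filtration vanishes), which lives next to the named
fact `Crystalline.HodgeDeRhamDegeneratesModTorsion` in `Crystalline/HodgeDeRhamDegenerationProofs`.

References: P. Deligne, Publ. Math. IHÉS 35 (1968), Thm. 5.5; The Stacks project, Tags 056T (smooth
over a field is geometrically reduced), 01W6/01WB (universally closed morphisms and integrality of
global sections), 09NQ-style separability of squarefree polynomials in characteristic `0`. [folklore]
-/

noncomputable section

open CategoryTheory Opposite TopologicalSpace Polynomial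
open scoped TensorProduct

universe u

/-! ### The algebraic lemma: derivations kill integral elements -/

namespace Literature.AlgebraicGeometry.Crystalline

section Algebra

variable {K₀ R : Type*} [Field K₀] [CommRing R] [Algebra K₀ R] [IsReduced R]

/-- Over a field, the minimal polynomial of an (integral) element of a REDUCED algebra is
squarefree: if `q² ∣ P` with `P = q² r` then `(q r)(x)² = P(x) r(x) = 0`, so `(q r)(x) = 0`,
`P ∣ q r` and `q` is a unit. [folklore] -/
theorem squarefree_minpoly_of_isReduced {x : R} (hx : IsIntegral K₀ x) :
    Squarefree (minpoly K₀ x) := by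
  intro q hq
  obtain ⟨r, hr⟩ := hq
  have hP0 : minpoly K₀ x ≠ 0 := minpoly.ne_zero hx
  have hnil : IsNilpotent (aeval x (q * r)) := by
    refine ⟨2, ?_⟩
    have : (q * r) ^ 2 = minpoly K₀ x * r := by rw [hr]; ring
    rw [← map_pow, this, map_mul, minpoly.aeval, zero_mul]
  have hdvd : minpoly K₀ x ∣ q * r := minpoly.dvd K₀ x hnil.eq_zero
  rw [hr] at hdvd hP0
  obtain ⟨s, hs⟩ := hdvd
  have hqr : q * r ≠ 0 := by
    intro h
    apply hP0
    calc q * q * r = q * (q * r) := by ring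
      _ = 0 := by rw [h, mul_zero]
  have h1 : q * r * 1 = q * r * (q * s) := by
    calc q * r * 1 = q * r := mul_one _
      _ = q * q * r * s := hs
      _ = q * r * (q * s) := by ring
  exact IsUnit.of_mul_eq_one s (mul_left_cancel₀ hqr h1).symm

/-- In characteristic `0` the minimal polynomial of an element of a reduced algebra over a field is
separable (squarefree ⇒ separable over a perfect field). [folklore] -/
theorem separable_minpoly_of_isReduced [CharZero K₀] {x : R} (hx : IsIntegral K₀ x) :
    (minpoly K₀ x).Separable :=
  PerfectField.separable_iff_squarefree.mpr (squarefree_minpoly_of_isReduced hx)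

variable {R₀ A M : Type*} [CommRing R₀] [IsDomain R₀] [Algebra R₀ K₀] [IsFractionRing R₀ K₀]
  [CommRing A] [Algebra R₀ A] [Algebra R₀ R] [IsScalarTower R₀ K₀ R]
  [AddCommGroup M] [Module A M] [Module R₀ M] [IsScalarTower R₀ A M]

/-- **Derivations kill integral elements.** Let `R₀` be a domain whose fraction field `K₀` has
characteristic `0`, `A` an `R₀`-algebra with an INJECTIVE `R₀`-algebra map `ι` into a REDUCED
`K₀`-algebra `R`, `M` an `A`-module without `R₀`-torsion and `D : A → M` an `R₀`-derivation. Then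
`D a = 0` for every `a ∈ A` integral over `R₀`: with `P` the (separable) minimal polynomial of
`ι a` over `K₀`, `u P + v P' = 1`, and `Q = c P`, `V = e v` cleared of denominators
(`c, e ∈ R₀ ∖ 0`), one has `Q(a) = 0`, hence `Q'(a) · D a = 0`, and `V(a) Q'(a) = e c` in `A`
(checked in `R`), so `(e c) · D a = 0`. [folklore] -/
theorem derivation_eq_zero_of_isIntegral_of_injective [CharZero K₀] (ι : A →ₐ[R₀] R)
    (hι : Function.Injective ι) (hM : ∀ r : R₀, r ≠ 0 → ∀ m : M, r • m = 0 → m = 0)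
    (D : Derivation R₀ A M) {a : A} (ha : IsIntegral R₀ a) : D a = 0 := by
  classical
  set x : R := ι a with hxdef
  have hx : IsIntegral K₀ x := (ha.map ι).tower_top
  set P : K₀[X] := minpoly K₀ x with hPdef
  obtain ⟨u, v, huv⟩ := separable_minpoly_of_isReduced (K₀ := K₀) hx
  -- clear denominators
  obtain ⟨c, hc, hQ⟩ := IsLocalization.integerNormalization_spec (nonZeroDivisors R₀) P
  obtain ⟨e, he, hV⟩ := IsLocalization.integerNormalization_spec (nonZeroDivisors R₀) v
  set Q : R₀[X] := IsLocalization.integerNormalization (nonZeroDivisors R₀) P with hQdef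
  set V : R₀[X] := IsLocalization.integerNormalization (nonZeroDivisors R₀) v with hVdef
  -- evaluation at `x` of the cleared polynomials
  have hPx : aeval x P = 0 := minpoly.aeval K₀ x
  have hvP' : aeval x v * aeval x (derivative P) = 1 := by
    have h := congrArg (aeval x) huv
    rwa [map_add, map_mul, map_mul, hPx, mul_zero, zero_add, map_one] at h
  have hVx : aeval x V = e • aeval x v := by
    rw [← Polynomial.aeval_map_algebraMap K₀ x V, hV, ← algebraMap_smul K₀ e v, map_smul,
      algebraMap_smul]
  have hQ'x : aeval x (derivative Q) = c • aeval x (derivative P) := by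
    rw [← Polynomial.aeval_map_algebraMap K₀ x (derivative Q), ← Polynomial.derivative_map, hQ,
      Polynomial.derivative_smul, ← algebraMap_smul K₀ c (derivative P), map_smul, algebraMap_smul]
  -- (1) `Q(a) = 0` in `A`
  have hQa : aeval a Q = 0 := by
    apply hι
    rw [map_zero, ← Polynomial.aeval_algHom_apply]
    exact IsLocalization.integerNormalization_aeval_eq_zero (nonZeroDivisors R₀) P hPx
  -- (2) `Q'(a) • D a = 0`
  have hD : aeval a (derivative Q) • D a = 0 := by
    rw [← Derivation.map_aeval, hQa, map_zero]
  -- (3) `V(a) Q'(a) = e c` in `A`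
  have key : aeval a V * aeval a (derivative Q) = algebraMap R₀ A (e * c) := by
    apply hι
    rw [map_mul, ← Polynomial.aeval_algHom_apply, ← Polynomial.aeval_algHom_apply,
      AlgHom.commutes, ← hxdef, hVx, hQ'x, smul_mul_smul_comm, hvP', Algebra.algebraMap_eq_smul_one]
  -- (4) torsion-freeness
  have hec : e * c ≠ 0 := mul_ne_zero (nonZeroDivisors.ne_zero he) (nonZeroDivisors.ne_zero hc)
  refine hM (e * c) hec (D a) ?_
  rw [← algebraMap_smul A (e * c) (D a), ← key, mul_smul, hD, smul_zero]

end Algebra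

/-! ### Standard smooth affine charts of a scheme smooth of relative dimension `d` -/

section Charts

open _root_.AlgebraicGeometry Literature.AlgebraicGeometry.Motives

-- `TopCat.Presheaf`/`TopCat.Sheaf` are not reducible: as in Mathlib's `AlgebraicGeometry.Modules`.
set_option backward.isDefEq.respectTransparency false

variable {R₀ : Type u} [CommRing R₀] (X : Over (Spec (CommRingCat.of R₀))) (d : ℕ)

/-- Inside every open neighbourhood of a point of an `R₀`-scheme smooth of relative dimension `d`
there is an affine open `V` on which the structure map `R₀ → Γ(X, V)` (the component of the tree's
`Motives.constToPresheaf X`) is standard smooth of relative dimension `d` (Mathlib's definition of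
`SmoothOfRelativeDimension`, unwound on basic opens). [folklore] -/
theorem exists_isStandardSmoothOfRelativeDimension_chart_le [SmoothOfRelativeDimension d X.hom]
    {U : X.left.Opens} {x : X.left} (hx : x ∈ U) :
    ∃ V : X.left.Opens, IsAffineOpen V ∧ x ∈ V ∧ V ≤ U ∧
      ((constToPresheaf X).app (op V)).hom.IsStandardSmoothOfRelativeDimension d := by
  obtain ⟨W, hW, hxW, hWU⟩ := exists_isAffineOpen_mem_and_subset (U := U) hx
  have hloc := HasRingHomProperty.appLE (@SmoothOfRelativeDimension d) X.hom ‹_›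
    ⟨⊤, isAffineOpen_top _⟩ ⟨W, hW⟩ le_top
  obtain ⟨s, hs, hst⟩ := (RingHom.locally_iff_isLocalization
    RingHom.isStandardSmoothOfRelativeDimension_respectsIso _).mp hloc
  obtain ⟨⟨t, ht⟩, hxt⟩ := Opens.mem_iSup.mp
    (hW.self_le_iSup_basicOpen_iff.mpr (by exact_mod_cast hs) hxW)
  refine ⟨X.left.basicOpen t, hW.basicOpen t, hxt, (X.left.basicOpen_le t).trans hWU, ?_⟩
  haveI := hW.isLocalization_basicOpen t
  have hfg : ((constToPresheaf X).app (op (X.left.basicOpen t))).hom =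
      (algebraMap Γ(X.left, W) Γ(X.left, X.left.basicOpen t)).comp
        ((constToPresheaf X).app (op W)).hom := by
    ext r
    have h := CategoryTheory.congr_fun
      ((constToPresheaf X).naturality (homOfLE (X.left.basicOpen_le t)).op) r
    simp only [Functor.const_obj_map, CommRingCat.comp_apply] at h
    exact h
  have h1 : ((constToPresheaf X).app (op W)).hom = (X.hom.appLE ⊤ W le_top).hom.comp
      (Scheme.ΓSpecIso (CommRingCat.of R₀)).commRingCatIsoToRingEquiv.symm.toRingHom :=
    RingHom.ext fun r => rfl
  rw [hfg, h1, ← RingHom.comp_assoc]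
  exact RingHom.isStandardSmoothOfRelativeDimension_respectsIso.2 _ _
    (hst t ht Γ(X.left, X.left.basicOpen t))

/-- The standard smooth affine charts form a basis of the topology. [folklore] -/
theorem isBasis_setOf_isStandardSmoothOfRelativeDimension_chart
    [SmoothOfRelativeDimension d X.hom] :
    Opens.IsBasis {V : X.left.Opens | IsAffineOpen V ∧
      ((constToPresheaf X).app (op V)).hom.IsStandardSmoothOfRelativeDimension d} := by
  refine Opens.isBasis_iff_nbhd.mpr fun {U x} hx => ?_
  obtain ⟨V, hV, hxV, hVU, hs⟩ := exists_isStandardSmoothOfRelativeDimension_chart_le X d hx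
  exact ⟨V, ⟨hV, hs⟩, hxV, hVU⟩

/-- **Global functions of a universally closed `R₀`-scheme are integral over `R₀`**, read on an
open `V`: for `b ∈ Γ(X, 𝒪_X)`, the restriction `b|_V` is integral over `R₀` for the structure map
`R₀ → Γ(X, V)` (Mathlib `isIntegral_appTop_of_universallyClosed`, transported along
`R₀ ≅ Γ(Spec R₀)` and the restriction). [folklore] -/
theorem isIntegralElem_map_of_universallyClosed [UniversallyClosed X.hom] (V : X.left.Opens)
    (b : Γ(X.left, ⊤)) :
    ((constToPresheaf X).app (op V)).hom.IsIntegralElem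
      (X.left.presheaf.map (homOfLE (le_top : V ≤ ⊤)).op b) := by
  have h0 : ((Scheme.ΓSpecIso (CommRingCat.of R₀)).inv ≫ X.hom.appTop).hom.IsIntegral := by
    have h2 : (Scheme.ΓSpecIso (CommRingCat.of R₀)).inv.hom.IsIntegral := by
      refine RingHom.isIntegral_of_surjective _ fun y => ⟨(Scheme.ΓSpecIso _).hom y, ?_⟩
      exact CategoryTheory.Iso.hom_inv_id_apply _ y
    exact RingHom.IsIntegral.trans _ _ h2 (isIntegral_appTop_of_universallyClosed X.hom)
  obtain ⟨p, hp, hpb⟩ := h0 b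
  refine ⟨p, hp, ?_⟩
  change eval₂ ((X.left.presheaf.map (homOfLE (le_top : V ≤ ⊤)).op).hom.comp
    ((Scheme.ΓSpecIso (CommRingCat.of R₀)).inv ≫ X.hom.appTop).hom) _ p = 0
  rw [← Polynomial.hom_eval₂, hpb, map_zero]

variable [IsDomain R₀] [CharZero R₀]

/-- **`d f = 0` for a global function `f` on a smooth, universally closed `R₀`-scheme** (`R₀` a
domain of characteristic `0`), on a standard smooth affine chart `V`: the Kähler differential
`D (f|_V) ∈ Ω[Γ(X,V)⁄R₀]` vanishes. (`Γ(X, V)` is flat over `R₀` and `K₀ ⊗ Γ(X, V)` is smooth over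
the field `K₀ = Frac R₀`, hence reduced; `Ω[Γ(X,V)⁄R₀]` is free; `f|_V` is integral over `R₀`;
apply `derivation_eq_zero_of_isIntegral_of_injective`.) The degree-`(0,0)` entry of Hodge–de Rham
degeneration, Deligne 1968 Thm. 5.5 (ii), in its elementary integral form. [folklore] -/
theorem kaehlerDifferential_D_map_eq_zero [SmoothOfRelativeDimension d X.hom]
    [UniversallyClosed X.hom] {V : X.left.Opens}
    (hs : ((constToPresheaf X).app (op V)).hom.IsStandardSmoothOfRelativeDimension d)
    (b : Γ(X.left, ⊤)) :
    letI : Algebra R₀ Γ(X.left, V) := ((constToPresheaf X).app (op V)).hom.toAlgebra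
    KaehlerDifferential.D R₀ Γ(X.left, V)
      (X.left.presheaf.map (homOfLE (le_top : V ≤ ⊤)).op b) = 0 := by
  letI : Algebra R₀ Γ(X.left, V) := ((constToPresheaf X).app (op V)).hom.toAlgebra
  haveI : Algebra.IsStandardSmoothOfRelativeDimension d R₀ Γ(X.left, V) := hs
  haveI : Algebra.IsStandardSmooth R₀ Γ(X.left, V) :=
    Algebra.IsStandardSmoothOfRelativeDimension.isStandardSmooth d
  let K₀ : Type u := FractionRing R₀
  haveI : CharZero K₀ := charZero_of_injective_algebraMap (IsFractionRing.injective R₀ K₀)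
  -- the reduced `K₀`-algebra `K₀ ⊗ Γ(X, V)` and the injection into it
  haveI : IsReduced (K₀ ⊗[R₀] Γ(X.left, V)) :=
    isReduced_of_smooth_of_field K₀ (K₀ ⊗[R₀] Γ(X.left, V))
  have hι : Function.Injective
      (Algebra.TensorProduct.includeRight : Γ(X.left, V) →ₐ[R₀] K₀ ⊗[R₀] Γ(X.left, V)) := by
    have h := Module.Flat.rTensor_preserves_injective_linearMap (M := Γ(X.left, V))
      (Algebra.linearMap R₀ K₀) (IsFractionRing.injective R₀ K₀)
    intro x y hxy
    apply (TensorProduct.lid R₀ Γ(X.left, V)).symm.injective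
    apply h
    simpa only [LinearMap.rTensor_tmul, TensorProduct.lid_symm_apply, Algebra.linearMap_apply,
      map_one, Algebra.TensorProduct.includeRight_apply] using hxy
  -- `Ω[Γ(X,V)⁄R₀]` is free over the flat `R₀`-algebra `Γ(X, V)`, hence `R₀`-torsion-free
  have hM : ∀ r : R₀, r ≠ 0 → ∀ m : Ω[Γ(X.left, V)⁄R₀], r • m = 0 → m = 0 := by
    intro r hr m hm
    haveI : Module.Flat R₀ (Ω[Γ(X.left, V)⁄R₀]) := Module.Flat.trans R₀ Γ(X.left, V) _
    exact Module.Flat.isSMulRegular_of_nonZeroDivisors (M := Ω[Γ(X.left, V)⁄R₀])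
      (mem_nonZeroDivisors_of_ne_zero hr) (hm.trans (smul_zero r).symm)
  have hb : IsIntegral R₀ (X.left.presheaf.map (homOfLE (le_top : V ≤ ⊤)).op b) :=
    isIntegralElem_map_of_universallyClosed X V b
  exact derivation_eq_zero_of_isIntegral_of_injective (K₀ := K₀) _ hι hM
    (KaehlerDifferential.D R₀ Γ(X.left, V)) hb

end Charts

/-! ### Degree `0` at the level of one ring map: `d` of a `0`-form is `D` of the function -/

namespace DeRhamComplexPresheaf

/-- The underlying element of the exterior algebra of `zeroEquiv.symm r ∈ ⋀⁰ M` is `algebraMap r`.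
[folklore] -/
theorem coe_zeroEquiv_symm (R M : Type*) [CommRing R] [AddCommGroup M] [Module R M] (r : R) :
    (((exteriorPower.zeroEquiv R M).symm r : ⋀[R]^0 M) : ExteriorAlgebra R M) =
      algebraMap R (ExteriorAlgebra R M) r := by
  rw [exteriorPower.zeroEquiv_symm_apply, Submodule.coe_smul, exteriorPower.ιMulti_apply_coe,
    ExteriorAlgebra.ιMulti_zero_apply, Algebra.smul_def, mul_one]

variable {A B A' B' : CommRingCat.{u}} {f : A ⟶ B} {f' : A' ⟶ B'} {g : A ⟶ A'} {g' : B ⟶ B'}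

/-- **In degree `0` the pull-back of forms is the ring map**: through `⋀⁰ ≅ B`, `homMap fac 0`
sends `b` to `g' b`. [folklore] -/
theorem homMap_zero_zeroEquiv_symm (fac : g ≫ f' = f ≫ g') (b : B) :
    letI := f.hom.toAlgebra
    letI := f'.hom.toAlgebra
    homMap fac 0 ((exteriorPower.zeroEquiv B (Ω[B⁄A])).symm b) =
      (exteriorPower.zeroEquiv B' (Ω[B'⁄A'])).symm (g' b) := by
  letI := f.hom.toAlgebra
  letI := f'.hom.toAlgebra
  letI := g.hom.toAlgebra
  letI := g'.hom.toAlgebra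
  letI := (g ≫ f').hom.toAlgebra
  haveI : IsScalarTower A A' B' := IsScalarTower.of_algebraMap_eq' rfl
  haveI : IsScalarTower A B B' := IsScalarTower.of_algebraMap_eq' (congrArg CommRingCat.Hom.hom fac)
  apply Subtype.ext
  change KaehlerExteriorDerivative.formsMap A A' B B'
      (((exteriorPower.zeroEquiv B (Ω[B⁄A])).symm b : ⋀[B]^0 (Ω[B⁄A])) : ExteriorAlgebra B _) =
    (((exteriorPower.zeroEquiv B' (Ω[B'⁄A'])).symm (g' b) : ⋀[B']^0 (Ω[B'⁄A'])) :
      ExteriorAlgebra B' _)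
  rw [coe_zeroEquiv_symm, coe_zeroEquiv_symm, KaehlerExteriorDerivative.formsMap_algebraMap]
  rfl

/-- Through `⋀⁰ ≅ B`, `homMap fac 0` is the ring map `g'`. [folklore] -/
theorem zeroEquiv_homMap_zero (fac : g ≫ f' = f ≫ g') (y : homForms f 0) :
    letI := f.hom.toAlgebra
    letI := f'.hom.toAlgebra
    exteriorPower.zeroEquiv B' (Ω[B'⁄A']) (homMap fac 0 y) =
      g' (exteriorPower.zeroEquiv B (Ω[B⁄A]) y) := by
  letI := f.hom.toAlgebra
  letI := f'.hom.toAlgebra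
  obtain ⟨b, rfl⟩ : ∃ b : B, y = (exteriorPower.zeroEquiv B (Ω[B⁄A])).symm b :=
    ⟨_, (LinearEquiv.symm_apply_apply _ y).symm⟩
  rw [homMap_zero_zeroEquiv_symm, LinearEquiv.apply_symm_apply, LinearEquiv.apply_symm_apply]

/-- **`d` of a `0`-form vanishes when `D` of the function does**: for `y ∈ ⋀⁰ Ω[B⁄A]`,
`homD f 0 y = 0` as soon as `D (zeroEquiv y) = 0` (the tree's
`oneEquiv_kaehlerExteriorDerivative_zero`: in degree `0`, `d = D` through `⋀⁰ ≅ B`, `⋀¹ ≅ Ω`).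
[folklore] -/
theorem homD_zero_apply_eq_zero (y : homForms f 0)
    (h : letI := f.hom.toAlgebra
      KaehlerDifferential.D A B (exteriorPower.zeroEquiv B (Ω[B⁄A]) y) = 0) :
    homD f 0 y = 0 := by
  letI := f.hom.toAlgebra
  change KaehlerExteriorDerivative.kaehlerExteriorDerivative A B 0 y = (0 : ↥(⋀[B]^1 (Ω[B⁄A])))
  apply (exteriorPower.oneEquiv B (Ω[B⁄A])).injective
  rw [KaehlerExteriorDerivative.oneEquiv_kaehlerExteriorDerivative_zero, h, map_zero]

/-- Pull back a `0`-form along `fac` and differentiate: zero as soon as `D (g' (zeroEquiv y)) = 0`.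
[folklore] -/
theorem homD_zero_homMap_zero_apply_eq_zero (fac : g ≫ f' = f ≫ g') (y : homForms f 0)
    (h : letI := f.hom.toAlgebra
      letI := f'.hom.toAlgebra
      KaehlerDifferential.D A' B' (g' (exteriorPower.zeroEquiv B (Ω[B⁄A]) y)) = 0) :
    homD f' 0 (homMap fac 0 y) = 0 := by
  apply homD_zero_apply_eq_zero
  rw [zeroEquiv_homMap_zero]
  exact h

end DeRhamComplexPresheaf

/-! ### The degree-`0` differential of `Ω•_{X/R₀}` kills global sections -/

section Sheaf

open _root_.AlgebraicGeometry Literature.AlgebraicGeometry.Motives DeRhamComplexPresheaf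
  KaehlerExteriorDerivative

-- `TopCat.Presheaf`/`TopCat.Sheaf` are not reducible: as in Mathlib's `AlgebraicGeometry.Modules`.
set_option backward.isDefEq.respectTransparency false

variable {R₀ : Type u} [CommRing R₀] [IsDomain R₀] [CharZero R₀] (X : Over (Spec (CommRingCat.of R₀)))
  (d : ℕ) [SmoothOfRelativeDimension d X.hom] [UniversallyClosed X.hom]

/-- `kaehlerDifferential_D_map_eq_zero`, spelled with the section rings exactly as the presheaf of
forms of `Motives.constToPresheaf X` sees them (base ring `(const R₀)(V)`, algebra structure
`(constToPresheaf X).app (op V)`). [folklore] -/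
theorem kaehlerDifferential_D_map_eq_zero' {V : X.left.Opens}
    (hs : ((constToPresheaf X).app (op V)).hom.IsStandardSmoothOfRelativeDimension d)
    (hV : V ≤ ⊤) (b : X.left.presheaf.obj (op ⊤)) :
    letI := ((constToPresheaf X).app (op V)).hom.toAlgebra
    KaehlerDifferential.D (((Functor.const (Opens X.left)ᵒᵖ).obj (CommRingCat.of R₀)).obj (op V))
      (X.left.presheaf.obj (op V)) (X.left.presheaf.map (homOfLE hV).op b) = 0 :=
  kaehlerDifferential_D_map_eq_zero X d hs b

/-- On a standard smooth chart `V`, the presheaf-level exterior derivative kills the restriction of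
every GLOBAL `0`-form (read in the bundled one-ring-map form through `formsPresheaf_map`, then
`homD_zero_homMap_zero_apply_eq_zero` and `kaehlerDifferential_D_map_eq_zero'`). [folklore] -/
theorem dApp_zero_map_eq_zero {V : X.left.Opens}
    (hs : ((constToPresheaf X).app (op V)).hom.IsStandardSmoothOfRelativeDimension d)
    (hV : V ≤ ⊤) (y : (formsPresheaf (constToPresheaf X) 0).obj (op ⊤)) :
    dApp (constToPresheaf X) (op V) 0
      ((formsPresheaf (constToPresheaf X) 0).map (homOfLE hV).op y) = 0 := by
  rw [formsPresheaf_map]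
  exact homD_zero_homMap_zero_apply_eq_zero _ y
    (kaehlerDifferential_D_map_eq_zero' X d hs hV _)

include d in
/-- **The degree-`0` differential `𝒪_X = Ω⁰ →ᵈ Ω¹_{X/R₀}` of the algebraic de Rham complex kills
every global section**, for `X → Spec R₀` smooth of relative dimension `d` and universally closed
over a domain `R₀` of characteristic `0`: a global section of `Ω⁰ = (𝒪_X)^{sh}` is (the image of)
a global function `f` (the presheaf of `0`-forms is already a sheaf), `d f` restricts on each
standard smooth chart `V` to the sheafification of `D (f|_V) = 0`
(`kaehlerDifferential_D_map_eq_zero`), and these charts cover `X`. The `(0, 0)` entry of the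
`E₁`-degeneration of Hodge–de Rham (Deligne 1968, Thm. 5.5 (ii)), integrally. [folklore] -/
theorem algebraicDeRhamComplex_d_app_top_eq_zero
    (s : ((algebraicDeRhamComplex X).X 0).obj.obj (op ⊤)) :
    ((algebraicDeRhamComplex X).d 0 1).hom.app (op ⊤) s = 0 := by
  -- (i) the presheaf of `0`-forms is a sheaf (it is `𝒪_X` through `⋀⁰ ≅ 𝒪`), so `s` comes from a
  -- global `0`-form
  have hsh : Presheaf.IsSheaf (Opens.grothendieckTopology X.left)
      (formsPresheaf (constToPresheaf X) 0) :=
    (Presheaf.isSheaf_of_iso_iff ((PresheafOfModules.toPresheaf _).mapIso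
      (exteriorPowerPresheafZeroIso
        (PresheafOfModules.DifferentialsConstruction.relativeDifferentials'
          (constToPresheaf X))))).mpr
      ((SheafOfModules.toSheaf X.left.ringCatSheaf).obj
        (SheafOfModules.unit X.left.ringCatSheaf)).property
  haveI : IsIso (toSheafify (Opens.grothendieckTopology X.left)
      (formsPresheaf (constToPresheaf X) 0)) :=
    isIso_toSheafify _ hsh
  -- (ii) `d = (d_presheaf)^{sh}`; reduce to the morphism statement `d_presheaf(⊤) ≫ sh = 0`
  have hd : ((algebraicDeRhamComplex X).d 0 1).hom =
      sheafifyMap (Opens.grothendieckTopology X.left) (deRhamDifferential (constToPresheaf X) 0) := by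
    change ((presheafToSheaf (Opens.grothendieckTopology X.left) AddCommGrpCat.{u}).map
      ((deRhamComplexPresheaf (constToPresheaf X)).d 0 1)).hom = _
    rw [deRhamComplexPresheaf_d]
  rw [hd]
  obtain ⟨y, rfl⟩ := (ConcreteCategory.bijective_of_isIso
    ((toSheafify (Opens.grothendieckTopology X.left)
      (formsPresheaf (constToPresheaf X) 0)).app (op ⊤))).2 s
  suffices h : (toSheafify (Opens.grothendieckTopology X.left)
      (formsPresheaf (constToPresheaf X) 0)).app (op ⊤) ≫
        (sheafifyMap (Opens.grothendieckTopology X.left)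
          (deRhamDifferential (constToPresheaf X) 0)).app (op ⊤) = 0 by
    have hy := ConcreteCategory.congr_hom h y
    rwa [ConcreteCategory.comp_apply] at hy
  rw [← NatTrans.comp_app, ← toSheafify_naturality, NatTrans.comp_app]
  ext y
  rw [ConcreteCategory.comp_apply]
  change _ = (0 : _ →+ _) y
  rw [AddMonoidHom.zero_apply]
  -- (iii) sheaf locality for `Ω¹ = (P¹)^{sh}` along the cover by standard smooth charts
  obtain ⟨Us, hUs, hU⟩ := (Opens.isBasis_iff_cover.mp
    (isBasis_setOf_isStandardSmoothOfRelativeDimension_chart X d)) ⊤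
  have hle : ∀ V : Us, (V : X.left.Opens) ≤ ⊤ := fun V => le_top
  have hcover : (⊤ : X.left.Opens) ≤ ⨆ V : Us, (V : X.left.Opens) := by
    rw [hU, sSup_eq_iSup']
  refine TopCat.Sheaf.eq_of_locally_eq'
    ((presheafToSheaf (Opens.grothendieckTopology X.left) AddCommGrpCat.{u}).obj
      (formsPresheaf (constToPresheaf X) (0 + 1)))
    (fun V : Us => (V : X.left.Opens)) ⊤ (fun V => homOfLE (hle V)) hcover _ 0 fun V => ?_
  rw [map_zero]
  -- (iv) `(sh (d y))|_V = sh ((d y)|_V) = sh (d (y|_V)) = sh 0`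
  have h2 := ConcreteCategory.congr_hom
    ((toSheafify (Opens.grothendieckTopology X.left)
      (formsPresheaf (constToPresheaf X) (0 + 1))).naturality (homOfLE (hle V)).op)
    ((deRhamDifferential (constToPresheaf X) 0).app (op ⊤) y)
  rw [ConcreteCategory.comp_apply, ConcreteCategory.comp_apply] at h2
  have h3 := ConcreteCategory.congr_hom
    ((deRhamDifferential (constToPresheaf X) 0).naturality (homOfLE (hle V)).op) y
  rw [ConcreteCategory.comp_apply, ConcreteCategory.comp_apply] at h3
  change ((sheafify (Opens.grothendieckTopology X.left)
      (formsPresheaf (constToPresheaf X) (0 + 1))).map (homOfLE (hle V)).op)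
    (((toSheafify (Opens.grothendieckTopology X.left)
      (formsPresheaf (constToPresheaf X) (0 + 1))).app (op ⊤))
        ((deRhamDifferential (constToPresheaf X) 0).app (op ⊤) y)) = 0
  rw [← h2, ← h3, deRhamDifferential_app, dApp_zero_map_eq_zero X d (hUs V.2).2 (hle V) y, map_zero]

end Sheaf

end Literature.AlgebraicGeometry.Crystalline

end
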